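import Summits.BirchSwinnertonDyer.BirchSwinnertonDyer.Theorems.SignedLowerHalvesSprungLowerDivisibilityAtThreeChromaticGlueRankSplit
import Summits.BirchSwinnertonDyer.BirchSwinnertonDyer.Theses.PrintX8VS
import HarnessLib

/-!
# Crux `SprungLowerDivisibilityAtThree` (item stmt-BirchSwinnertonDyer-19875) on route `PrintX8VS` (split gen 1, rev 8):
# the GLUE ITEM `SprungLowerDivisibilityAtThreeOfChromaticParts` (stmt-BirchSwinnertonDyer-26785) HOLDS

Cell `bsd-ssimc` (host) / lead `cruxlead-stmt-BirchSwinnertonDyer-19875` (g2); the x8 planner's ask (i) after the split executed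
2026-08-28T07:49:48Z: the glue item says `C1 → C2 → C3 → C4 → K1` with C1 `ChromaticCoprimalityX8` (= v6 stub S2), C2
`ChromaticCyclotomicLowerRestX8` (= S4b), C3 `ChromaticBothColoursPosRankX8` (= S0⁺), C4 `ChromaticHeldInputsX8` (= S5) — each child decl
is VERBATIM the corresponding hypothesis type of the landed kernel glue `ChromaticCommonZeros.…_printX8VS_of_chromaticStubs_rankSplit`
(p610926), so the proof is one application; it CLOSES the support item 26785 and nothing else.
C1, C2, C3 are OPEN cruxes, C4 is HELD; K1 / BSD / leaf X8 are NOT proved by anything here.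

References: [Sprung2012] Main Conj. 7.21 (p. 1505); [Sprung2015] Conj. 5.6; [Sprung2017] Conj. 4.12; [Kato2004Asterisque] Conj. 12.10 (p. 224);
tree `…ChromaticGlueRankSplit` (p610926), `Theses/PrintX8VS.lean` rev 8.
-/

set_option linter.dupNamespace false
set_option autoImplicit false

noncomputable section

open scoped Classical NumberField MatrixGroups ModularForm

open NumberField IsDedekindDomain CongruenceSubgroup WeierstrassCurve Field
  Literature.NumberTheory.EllipticCurves Literature.NumberTheory.EllipticCurves.ModularForms
  Literature.NumberTheory.EllipticCurves.ZpExtension Literature.NumberTheory.EllipticCurves.Sprung2017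
  Literature.NumberTheory.EllipticCurves.Sprung2012 Literature.NumberTheory.EllipticCurves.Rank1Residual
  Literature.NumberTheory.EllipticCurves.IwasawaAlgebra Literature.NumberTheory.EllipticCurves.Kato2004
  Summit.BirchSwinnertonDyer.BirchSwinnertonDyer.Theorems

namespace Summit.BirchSwinnertonDyer.BirchSwinnertonDyer.Theorems.ChromaticCommonZeros

/-- **The split glue of K1 on route `PrintX8VS` holds**: `ChromaticCoprimalityX8 → ChromaticCyclotomicLowerRestX8 →
ChromaticBothColoursPosRankX8 → ChromaticHeldInputsX8 → SprungLowerDivisibilityAtThree`, by the landed kernel glue of line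
`chromatic-common-zeros` (p610926) with `(h714, h3, hJ, hGZK, hKob) := C4`, `hS0 := C3`, `hS2 := C1`, `hS4b := C2`.
Unconditional as an implication; closes item stmt-BirchSwinnertonDyer-26785 and nothing else.
[cite: Sprung2012, Main Conj. 7.21 (p. 1505)] [cite: Sprung2015, Conj. 5.6] [cite: Sprung2017, Conj. 4.12] -/
theorem sprungLowerDivisibilityAtThreeOfChromaticParts_holds :
    Summit.BirchSwinnertonDyer.BirchSwinnertonDyer.Theses.PrintX8VS.SprungLowerDivisibilityAtThreeOfChromaticParts :=
  fun hS2 hS4b hS0 hIn =>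
    sprungLowerDivisibilityAtThree_printX8VS_of_chromaticStubs_rankSplit
      hIn.1 hIn.2.1 hIn.2.2.1 hIn.2.2.2.1 hIn.2.2.2.2 hS0 hS2 hS4b

end Summit.BirchSwinnertonDyer.BirchSwinnertonDyer.Theorems.ChromaticCommonZeros

end
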